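import Summits.AtomisticToContinuum.HydrodynamicLimit.Theorems.LocalSecondLaw.Negative.FalseWithoutLLN
import Summits.AtomisticToContinuum.HydrodynamicLimit.Theorems.LocalSecondLaw.Negative.FreeVolume
import Summits.AtomisticToContinuum.HydrodynamicLimit.Theorems.ImplosionDichotomyPolynomialCompressionStaticsLLN

/-!
# The time-support condition on the test function is load-bearing in `LocalSecondLaw`

Negative knowledge for the crux `JParityClosure.LocalSecondLaw` (stmt-AtomisticToContinuum-13081), from the
standing disprover's `Cruxes/LocalSecondLaw/Disproof.lean` §(a).  `LocalSecondLawWithoutSupport` is the crux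
VERBATIM with the hypothesis `∃ τ' < τ, ∀ s ≥ τ', φ s · = 0` deleted, and it is FALSE
(`localSecondLaw_false_without_support`, sorry-free): with `φ ≡ 1` the space–time term vanishes surely and
the event is decided by the boundary term; for particles `(1, e², 0)` with the MATCHED constant Euler state
`(1, 0, e²)` (identified `t = 0` LLN: `stub_staticsLLN`, limit density `rhoLim ≡ 1` for unit activity by
`empiricalDensityField_one`) the boundary term is `f_ex(σ³) - 3 ≤ -1 < -1/2` by the explicit EOS bound
`hsExcessFreeEnergy_le_two`, so the event is the whole space, of probability `1 > 1/2`.  Moral for provers: the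
inequality is genuinely a statement about `∂ₛφ`-weighted time averages; the boundary term alone has no sign.
refuter-cdisprove-stmt-AtomisticToContinuum-13081-0.
-/

noncomputable section

namespace Summit.AtomisticToContinuum.HydrodynamicLimit.Theorems.LocalSecondLawNegative

open MeasureTheory Filter Set Topology
open scoped ENNReal
open Literature.MathematicalPhysics.KineticTheory Literature.Analysis.FluidPDE

variable {N : ℕ}

/-- The crux with the time-support hypothesis `∃ τ' < τ, ∀ s ≥ τ', φ s · = 0` DELETED (verbatim
otherwise). -/
def LocalSecondLawWithoutSupport : Prop :=
  ∀ (a₀ θ₀ : Literature.MathematicalPhysics.KineticTheory.T3 → ℝ) (u₀ : Literature.MathematicalPhysics.KineticTheory.T3 → Literature.MathematicalPhysics.KineticTheory.V3), Continuous a₀ → Continuous θ₀ → Continuous u₀ → (∀ x, 0 < a₀ x) → (∀ x, 0 < θ₀ x) → ∃ σ₀ : ℝ, 0 < σ₀ ∧ ∀ σ : ℝ, 0 < σ → σ < σ₀ → ∀ (T : ℝ) (ρ θ : ℝ → Literature.MathematicalPhysics.KineticTheory.T3 → ℝ) (u : ℝ → Literature.MathematicalPhysics.KineticTheory.T3 →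 Literature.MathematicalPhysics.KineticTheory.V3), Literature.MathematicalPhysics.KineticTheory.IsHardSphereEulerSolution σ T ρ u θ → ∀ Φ : (N : ℕ) → Literature.Analysis.FluidPDE.HardSphereFlow (Literature.Analysis.FluidPDE.Torus.geometry (Fin 3)) (Literature.MathematicalPhysics.KineticTheory.hsDiameter σ N) (N + 1), Literature.MathematicalPhysics.KineticTheory.TendstoHydroFieldsAt (fun N => Literature.MathematicalPhysics.KineticTheory.localGibbsLaw σ a₀ u₀ θ₀ N (Φ N)) Φ ρ u θ 0 → 0 < T → ∀ τ : ℝ, 0 < τ → ∀ φ : ℝ → Literature.MathematicalPhysics.KineticTheory.T3 → ℝ, Literature.Analysis.FunctionSpaces.Torus.IsSmoothSpaceTimeOn Set.univ φ → (∀ s x, 0 ≤ φ s x) → ∀ η δ : ℝ, 0 < η → 0 < δ → ∃ r₀ : ℝ, 0 < r₀ ∧ ∀ r : ℝ, 0 < r → r < r₀ → ∃ N₀ : ℕ, ∀ N : ℕ, N₀ ≤ N → let γ : Literature.Analysis.FluidPDE.Config (N + 1) (Fin 3) Literature.MathematicalPhysics.KineticTheory.T3 → ℝ → Literature.Analysis.FluidPDE.Config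 (N + 1) (Fin 3) Literature.MathematicalPhysics.KineticTheory.T3 := fun z s => (Φ N).flow s z; let bx : Literature.MathematicalPhysics.KineticTheory.T3 → Literature.MathematicalPhysics.KineticTheory.T3 → ℝ := fun x y => 3 / (Real.pi * r ^ 3) * max (1 - Literature.Analysis.FluidPDE.Torus.euclidDist x y / r) 0; let ρm : Literature.Analysis.FluidPDE.Config (N + 1) (Fin 3) Literature.MathematicalPhysics.KineticTheory.T3 → ℝ → Literature.MathematicalPhysics.KineticTheory.T3 → ℝ := fun z s x₀ => ∫ q, bx q.1 x₀ ∂(Literature.Analysis.FluidPDE.empiricalMeasure (γ z s)); let mm : Literature.Analysis.FluidPDE.Config (N + 1) (Fin 3) Literature.MathematicalPhysics.KineticTheory.T3 → ℝ → Literature.MathematicalPhysics.KineticTheory.T3 → Literature.MathematicalPhysics.KineticTheory.V3 := fun z s x₀ => ∫ q, bx q.1 x₀ • q.2 ∂(Literature.Analysis.FluidPDE.empiricalMeasure (γ z s)); let em : Literature.Analysis.FluidPDE.Config (N + 1) (Fin 3) Literature.MathematicalPhysics.KineticTheory.T3 → ℝ → Literature.MathematicalPhysics.KineticTheory.T3 →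 ℝ := fun z s x₀ => ∫ q, bx q.1 x₀ * (‖q.2‖ ^ 2 / 2) ∂(Literature.Analysis.FluidPDE.empiricalMeasure (γ z s)); let θm : Literature.Analysis.FluidPDE.Config (N + 1) (Fin 3) Literature.MathematicalPhysics.KineticTheory.T3 → ℝ → Literature.MathematicalPhysics.KineticTheory.T3 → ℝ := fun z s x₀ => 2 / 3 * (em z s x₀ / ρm z s x₀ - ‖mm z s x₀‖ ^ 2 / (2 * ρm z s x₀ ^ 2)); let Hs : ℝ → ℝ → ℝ := fun a b => if 0 < a ∧ 0 < b then -(a * (3 / 2 * Real.log b - Real.log a - Literature.MathematicalPhysics.KineticTheory.hsExcessFreeEnergy (a * σ ^ 3))) else 0; let I : Literature.Analysis.FluidPDE.Config (N + 1) (Fin 3) Literature.MathematicalPhysics.KineticTheory.T3 → ℝ := fun z => ∫ s in Set.Icc (0 : ℝ) τ, ∫ x : Literature.MathematicalPhysics.KineticTheory.T3, Hs (ρm z s x) (θm z s x) * (deriv (fun s' => φ s' x) s + ∑ k : Fin 3, (mm z s x) k / ρm z s x * Literature.Analysis.FunctionSpaces.Torus.partialDeriv k (φ s) x); Literature.MathematicalPhysics.KineticTheory.localGibbsLaw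 σ a₀ u₀ θ₀ N (Φ N) {z | I z + ∫ x : Literature.MathematicalPhysics.KineticTheory.T3, Hs (ρ 0 x) (θ 0 x) * φ 0 x < -η} ≤ ENNReal.ofReal δ

/-- **`LocalSecondLaw` is false without the time-support condition on the test function** (the
hypothesis `∃ τ' < τ, ∀ s ≥ τ', φ s · = 0` is load-bearing).  With `φ ≡ 1` the space–time term vanishes
surely (`∂ₛφ = ∇φ = 0`, so `I z = 0` for EVERY `z`, junk or not) and the event is decided by the boundary
term alone: particles `(a₀,θ₀,u₀) = (1, e², 0)`, the MATCHED constant Euler state `(1, 0, e²)` (the `t = 0`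
LLN holds: `stub_staticsLLN` gives the limit density `rhoLim ≡ κ`, constant for constant activity, and
`κ = 1` by `empiricalDensityField_one` + `Φ.good` a.s.), Alexander's flows, `τ = T = 1`, `η = δ = 1/2`:
the boundary term is `f_ex(σ³) - 3 ≤ -1 < -1/2` by the explicit bound `hsExcessFreeEnergy_le_two`, so the
event is the whole space, of probability `1 > 1/2`. [folklore] -/
theorem localSecondLaw_false_without_support : ¬ LocalSecondLawWithoutSupport := by
  intro h
  set θ₀ : ℝ := Real.exp 2 with hθ₀
  have hθ₀pos : 0 < θ₀ := Real.exp_pos 2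
  have hc1 : Continuous (fun _ : T3 => (1 : ℝ)) := continuous_const
  have hcθ : Continuous (fun _ : T3 => θ₀) := continuous_const
  have hc0 : Continuous (fun _ : T3 => (0 : V3)) := continuous_const
  obtain ⟨σ₀, hσ₀, h1⟩ := h (fun _ => 1) (fun _ => θ₀) (fun _ => 0) hc1 hcθ hc0
    (fun _ => one_pos) (fun _ => hθ₀pos)
  obtain ⟨σ₁, hσ₁, hS⟩ := stub_staticsLLN (fun _ => 1) (fun _ => θ₀) (fun _ => 0) hc1 hcθ hc0
    (fun _ => one_pos) (fun _ => hθ₀pos)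
  obtain ⟨σ, hσpos, hσlt0, hσlt1, hσhalf⟩ : ∃ σ : ℝ, 0 < σ ∧ σ < σ₀ ∧ σ < σ₁ ∧ σ < 2⁻¹ := by
    refine ⟨min (min σ₀ σ₁) 2⁻¹ / 2, by positivity, ?_, ?_, ?_⟩ <;>
      linarith [min_le_left (min σ₀ σ₁) (2⁻¹ : ℝ), min_le_right (min σ₀ σ₁) (2⁻¹ : ℝ),
        min_le_left σ₀ σ₁, min_le_right σ₀ σ₁, lt_min (lt_min hσ₀ hσ₁) (show (0 : ℝ) < 2⁻¹ by norm_num)]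
  have hσhalf' : σ ≤ 1 / 2 := by rw [one_div]; exact hσhalf.le
  let Φ : (N : ℕ) → HardSphereFlow (Torus.geometry (Fin 3)) (hsDiameter σ N) (N + 1) := fun N =>
    Classical.choice (HardSphereFlow.nonempty_torus_holds (d := Fin 3) (hsDiameter_pos hσpos N)
      (lt_of_le_of_lt (hsDiameter_le hσpos.le N) hσhalf) (N + 1))
  have hprob : ∀ N, IsProbabilityMeasure (localGibbsLaw σ (fun _ => 1) (fun _ => 0) (fun _ => θ₀) N (Φ N)) :=
    fun N => isProbabilityMeasure_localGibbsLaw hc1 hcθ hc0 (fun _ => one_pos) (fun _ => hθ₀pos)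
      hσhalf' N (Φ N)
  obtain ⟨-, -, hTΦ⟩ := hS σ hσpos hσlt1
  have hT := hTΦ Φ
  -- the limit density is the constant 1
  set P := profileOf (fun _ : T3 => (1 : ℝ)) hc1 (fun _ => one_pos) with hP
  have hconst : ∀ y, rhoLim P σ y = rhoLim P σ 0 := fun y => by
    simp only [rhoLim, hP, profileOf_β]
  have hκ : rhoLim P σ 0 = 1 := by
    by_contra hne
    have hk : 0 < |1 - rhoLim P σ 0| := abs_pos.2 (sub_ne_zero.2 (Ne.symm hne))
    have hd := (hT (fun _ => 1) continuous_const (|1 - rhoLim P σ 0| / 2) (by positivity)).1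
    have hint : ∫ x : T3, (fun _ : T3 => (1 : ℝ)) x * (fun _ : ℝ => rhoLim P σ) 0 x = rhoLim P σ 0 := by
      show ∫ x : T3, (1 : ℝ) * rhoLim P σ x = rhoLim P σ 0
      simp_rw [one_mul, hconst]
      simp
    have hone : ∀ N, (1 : ℝ≥0∞) ≤ localGibbsLaw σ (fun _ => 1) (fun _ => 0) (fun _ => θ₀) N (Φ N)
        {z | |1 - rhoLim P σ 0| / 2 < |empiricalDensityField ((Φ N).flow 0 z) (fun _ => 1) -
          ∫ x : T3, (fun _ : T3 => (1 : ℝ)) x * (fun _ : ℝ => rhoLim P σ) 0 x|} := by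
      intro N
      haveI := hprob N
      have hac : localGibbsLaw σ (fun _ => 1) (fun _ => 0) (fun _ => θ₀) N (Φ N) ≪
          liouville (Torus.geometry (Fin 3)) (N + 1) (hsDiameter σ N) :=
        withDensity_absolutelyContinuous _ _
      have hg : ∀ᵐ z ∂(localGibbsLaw σ (fun _ => 1) (fun _ => 0) (fun _ => θ₀) N (Φ N)),
          z ∈ (Φ N).good := hac.ae_le (Φ N).ae_mem_good
      rw [← measure_univ (μ := localGibbsLaw σ (fun _ => 1) (fun _ => 0) (fun _ => θ₀) N (Φ N))]
      refine measure_mono_ae ?_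
      filter_upwards [hg] with z hz _
      show |1 - rhoLim P σ 0| / 2 < |empiricalDensityField ((Φ N).flow 0 z) (fun _ => 1) -
        ∫ x : T3, (fun _ : T3 => (1 : ℝ)) x * (fun _ : ℝ => rhoLim P σ) 0 x|
      rw [(Φ N).flow_zero z hz, empiricalDensityField_one (Nat.succ_ne_zero N), hint]
      exact half_lt_self hk
    have h10 : (1 : ℝ≥0∞) ≤ 0 := ge_of_tendsto' hd hone
    exact absurd h10 (by simp)
  have hρ : (fun (_ : ℝ) => rhoLim P σ) = fun (_ : ℝ) (_ : T3) => (1 : ℝ) := by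
    funext t x; rw [hconst x, hκ]
  rw [hρ] at hT
  -- run the crux frame with φ ≡ 1
  have hsol := constState_isSolution σ 1 hθ₀pos
  have hsmooth : Literature.Analysis.FunctionSpaces.Torus.IsSmoothSpaceTimeOn Set.univ
      (fun (_ : ℝ) (_ : T3) => (1 : ℝ)) := contDiffOn_const
  obtain ⟨r₀, hr₀, h3⟩ := h1 σ hσpos hσlt0 1 (fun _ _ => 1) (fun _ _ => θ₀) (fun _ _ => 0) hsol Φ
    hT one_pos 1 one_pos (fun _ _ => 1) hsmooth (fun _ _ => zero_le_one) (1 / 2) (1 / 2)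
    (by norm_num) (by norm_num)
  set r : ℝ := min (r₀ / 2) (1 / 4) with hr
  have hrpos : 0 < r := by positivity
  have hrlt : r < r₀ := lt_of_le_of_lt (min_le_left _ _) (by linarith)
  obtain ⟨N₀, h4⟩ := h3 r hrpos hrlt
  have h5 := h4 N₀ le_rfl
  change localGibbsLaw σ (fun _ => 1) (fun _ => 0) (fun _ => θ₀) N₀ (Φ N₀)
      {z | entropyFunctional σ r 1 (fun _ _ => (1 : ℝ)) (Φ N₀) z +
        ∫ x : T3, Hs σ ((fun _ _ => (1 : ℝ)) 0 x) ((fun _ _ => θ₀) 0 x) *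
          (fun (_ : ℝ) (_ : T3) => (1 : ℝ)) 0 x < -(1 / 2)} ≤ ENNReal.ofReal (1 / 2) at h5
  have hpd : ∀ (k : Fin 3) (x : T3),
      Literature.Analysis.FunctionSpaces.Torus.partialDeriv k (fun _ : T3 => (1 : ℝ)) x = 0 := by
    intro k x
    simp [Literature.Analysis.FunctionSpaces.Torus.partialDeriv,
      Literature.Analysis.FunctionSpaces.Torus.lineDeriv]
  have hI : ∀ z, entropyFunctional σ r 1 (fun (_ : ℝ) (_ : T3) => (1 : ℝ)) (Φ N₀) z = 0 := by
    intro z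
    unfold entropyFunctional
    simp [hpd]
  have hHs : Hs σ 1 θ₀ = hsExcessFreeEnergy (1 * σ ^ 3) - 3 := by
    unfold Hs
    rw [if_pos ⟨one_pos, hθ₀pos⟩, Real.log_one, hθ₀, Real.log_exp]
    ring
  have hinit : (∫ x : T3, Hs σ ((fun _ _ => (1 : ℝ)) 0 x) ((fun _ _ => θ₀) 0 x) *
      (fun (_ : ℝ) (_ : T3) => (1 : ℝ)) 0 x) = hsExcessFreeEnergy (1 * σ ^ 3) - 3 := by
    show (∫ _ : T3, Hs σ 1 θ₀ * 1) = _
    rw [integral_const, mul_one, hHs]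
    simp
  have hf2 : hsExcessFreeEnergy (1 * σ ^ 3) ≤ 2 := by
    rw [one_mul]; exact hsExcessFreeEnergy_le_two hσpos.le hσhalf'
  have huniv : {z | entropyFunctional σ r 1 (fun (_ : ℝ) (_ : T3) => (1 : ℝ)) (Φ N₀) z +
        ∫ x : T3, Hs σ ((fun _ _ => (1 : ℝ)) 0 x) ((fun _ _ => θ₀) 0 x) *
          (fun (_ : ℝ) (_ : T3) => (1 : ℝ)) 0 x < -(1 / 2)} = Set.univ := by
    refine Set.eq_univ_of_forall fun z => ?_
    rw [Set.mem_setOf_eq, hI z, hinit]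
    linarith
  rw [huniv] at h5
  haveI := hprob N₀
  rw [measure_univ] at h5
  have h6 : (1 : ℝ≥0∞).toReal ≤ 1 / 2 := ENNReal.toReal_le_of_le_ofReal (by norm_num) h5
  norm_num at h6

end Summit.AtomisticToContinuum.HydrodynamicLimit.Theorems.LocalSecondLawNegative

end
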